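import Mathlib.Analysis.Calculus.BumpFunction.SmoothApprox
import Literature.MathematicalPhysics.QuantumFieldTheory.LatticeGaugeDobrushin
import HarnessLib

/-!
# Venture YMGap — track (a), R119 brick L, part 1: SMOOTH LIPSCHITZ APPROXIMATION on a
# finite-dimensional real normed space (mollification keeps the Lipschitz constant)

HONEST FRAMING: venture file (cell `pub-ymgap`, track (a), seat ds-2, brick L for lit-1's R119 line).
Pure finite-dimensional analysis; no lattice, no measure on configurations, no physics.

For a `K`-Lipschitz real function `f` on a finite-dimensional real normed space `E` and `ε > 0` there
is a `C^∞` function `g` with the SAME Lipschitz constant `K` and `|g - f| ≤ Kε` everywhere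
(`LipschitzWith.exists_contDiff_lipschitzWith_dist_le`): `g = φ_ε ⋆ f` for a normed smooth bump
`φ_ε` supported in the `ε`-ball (Mathlib's `ContDiffBump.normed`, `HasCompactSupport.contDiff_convolution_left`,
`ContDiffBump.dist_normed_convolution_le`); the Lipschitz constant survives because the bump has mass
one and is nonnegative. This is the Lipschitz → smooth layer of the tight-limit step of the cell's
static proof of Shen–Zhu–Zhu's Corollary 4.11 (`SharpClusteringLimit.lean`): Lipschitz cylinder
functions of lattice gauge fields are uniformly approximated by smooth cylinder functions with the same
per-link Lipschitz constants.

References: H. Shen, R. Zhu, X. Zhu, CMP 400 (2023) 805–851, Cor. 4.11 (cylinder functions);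
L. Hörmander, *The Analysis of Linear Partial Differential Operators I*, Thm. 1.3.2 (regularisation).
-/

noncomputable section

open scoped ContDiff Topology NNReal Convolution
open MeasureTheory Metric Function Set

namespace Summit.Ventures.YMGap

namespace SharpClustering

variable {E : Type*} [NormedAddCommGroup E] [NormedSpace ℝ E] [FiniteDimensional ℝ E]

/-- **Mollification keeps the Lipschitz constant**: convolution of a `K`-Lipschitz real function with
a normed bump function (nonnegative, mass one) is `K`-Lipschitz. -/
theorem lipschitzWith_normed_convolution [MeasurableSpace E] [BorelSpace E] {μ : Measure E}
    [μ.IsAddHaarMeasure] (φ : ContDiffBump (0 : E)) {f : E → ℝ} {K : ℝ≥0} (hf : LipschitzWith K f) :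
    LipschitzWith K (φ.normed μ ⋆[ContinuousLinearMap.lsmul ℝ ℝ, μ] f) := by
  refine LipschitzWith.of_dist_le_mul fun x y => ?_
  have hφc : Continuous (φ.normed μ) := φ.continuous_normed
  have hφs : HasCompactSupport (φ.normed μ) := φ.hasCompactSupport_normed
  have hfc : Continuous f := hf.continuous
  -- the two convolution integrands are continuous with compact support, hence integrable
  have hint : ∀ z : E, Integrable (fun t => φ.normed μ t * f (z - t)) μ := fun z =>
    (hφc.mul (hfc.comp (continuous_const.sub continuous_id))).integrable_of_hasCompactSupport
      (hφs.mul_right)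
  have hconv : ∀ z : E, (φ.normed μ ⋆[ContinuousLinearMap.lsmul ℝ ℝ, μ] f) z =
      ∫ t, φ.normed μ t * f (z - t) ∂μ := fun z => by
    rw [convolution_def]; rfl
  rw [Real.dist_eq, hconv, hconv, ← integral_sub (hint x) (hint y)]
  have hbound : ∀ t, ‖φ.normed μ t * f (x - t) - φ.normed μ t * f (y - t)‖ ≤
      φ.normed μ t * (K * dist x y) := fun t => by
    rw [← mul_sub, norm_mul, Real.norm_of_nonneg (φ.nonneg_normed t)]
    refine mul_le_mul_of_nonneg_left ?_ (φ.nonneg_normed t)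
    have h := hf.dist_le_mul (x - t) (y - t)
    rw [dist_sub_right, Real.dist_eq] at h
    exact h
  calc |∫ t, (φ.normed μ t * f (x - t) - φ.normed μ t * f (y - t)) ∂μ|
      = ‖∫ t, (φ.normed μ t * f (x - t) - φ.normed μ t * f (y - t)) ∂μ‖ := (Real.norm_eq_abs _).symm
    _ ≤ ∫ t, φ.normed μ t * (K * dist x y) ∂μ :=
        norm_integral_le_of_norm_le ((φ.integrable_normed).mul_const _) (Filter.Eventually.of_forall hbound)
    _ = K * dist x y := by rw [integral_mul_const, φ.integral_normed, one_mul]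

/-- **Smooth Lipschitz approximation.** A `K`-Lipschitz real function on a finite-dimensional real
normed space is, for every `ε > 0`, uniformly `Kε`-close to a `C^∞` function with the same Lipschitz
constant `K`. -/
theorem _root_.LipschitzWith.exists_contDiff_lipschitzWith_dist_le {f : E → ℝ} {K : ℝ≥0}
    (hf : LipschitzWith K f) {ε : ℝ} (hε : 0 < ε) :
    ∃ g : E → ℝ, ContDiff ℝ ∞ g ∧ LipschitzWith K g ∧ ∀ x, dist (g x) (f x) ≤ K * ε := by
  borelize E
  set φ : ContDiffBump (0 : E) := ⟨ε / 2, ε, half_pos hε, half_lt_self hε⟩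
  refine ⟨φ.normed Measure.addHaar ⋆[ContinuousLinearMap.lsmul ℝ ℝ, Measure.addHaar] f, ?_, ?_, ?_⟩
  · exact φ.hasCompactSupport_normed.contDiff_convolution_left _ φ.contDiff_normed
      (hf.continuous.locallyIntegrable (μ := Measure.addHaar))
  · exact lipschitzWith_normed_convolution φ hf
  · intro a
    refine φ.dist_normed_convolution_le hf.continuous.aestronglyMeasurable fun x hx => ?_
    refine (hf.dist_le_mul x a).trans ?_
    exact mul_le_mul_of_nonneg_left (le_of_lt (mem_ball.1 hx)) K.2

/-! ### Smooth approximation of Lipschitz cylinder functions of lattice gauge fields -/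

section Cylinder

open Literature.MathematicalPhysics.QuantumFieldTheory
open Literature.MathematicalPhysics.QuantumLattice (LGConfig fundamentalRep)

variable {d N : ℕ}

/-- **Lipschitz cylinder functions are uniformly approximated by SMOOTH cylinder functions with the
same Lipschitz constant**: if `F = f((U_e)_{e ∈ Λ})` with `f` `K`-Lipschitz for the sup metric on the
matrix entries (`IsLipschitzCylinder`), then for every `η > 0` there is a `C^∞`, `K`-Lipschitz
`g` on `(Λ → Fin N → Fin N → ℂ)` with `|g((U_e)) - F(U)| ≤ Kη` for every configuration `U`. -/
theorem exists_contDiff_lipschitz_cylinder_approx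
    {F : LGConfig d (Matrix.specialUnitaryGroup (Fin N) ℂ) → ℝ} {Λ : Finset (Literature.MathematicalPhysics.QuantumLattice.ZdEdge d)} {K : ℝ≥0}
    (hF : IsLipschitzCylinder (fundamentalRep (Fin N)) F Λ K) {η : ℝ} (hη : 0 < η) :
    ∃ g : (↥Λ → Fin N → Fin N → ℂ) → ℝ, ContDiff ℝ ∞ g ∧ LipschitzWith K g ∧
      ∀ U, |g (fun e => suEntries (U e)) - F U| ≤ K * η := by
  obtain ⟨f, hf, hFf⟩ := hF.exists_suEntries
  obtain ⟨g, hg, hgK, hgf⟩ := hf.exists_contDiff_lipschitzWith_dist_le hη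
  refine ⟨g, hg, hgK, fun U => ?_⟩
  rw [hFf U, ← Real.dist_eq]
  exact hgf _

end Cylinder

end SharpClustering

end Summit.Ventures.YMGap
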